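import Summits.ResolutionOfSingularities.ResolutionOfSingularities.Theorems.MarkedTransferCampaignW46WWalkPortableStep
import Summits.ResolutionOfSingularities.ResolutionOfSingularities.Theorems.MarkedTransferCampaignW46WWalkNRPoint
import Summits.ResolutionOfSingularities.ResolutionOfSingularities.Theorems.MarkedTransferCampaignW46WWalkThread
import Summits.ResolutionOfSingularities.ResolutionOfSingularities.Theorems.MarkedTransferCampaignW46MohWindowShadeFormalNRWalkStep
import HarnessLib

/-!
# [OURS · L1 W4.6 rung (iii-2)] THE W-WALK ALONG A HIT THREAD over a perfect NON-closed ground field: `w`-anchors over the residue fields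
# of the thread points, model states read in `Ω⟦t, y, z⟧`, one step

Cell `res-hironaka`, LADDER-RESOLUTION rung L (D-0089), slot W4.6 rung (iii); seat res-L1-s46-pv-5 (gen 7). Host route MarkedTransfer,
`--supports stmt-ResolutionOfSingularities-16155 --as helper`; kind proof (def-free). Plan `HOME/L/res-L1-s46-pv-5/NOTES.md` (gen 7, file F5).
Template: this seat's gen-6 `…WWalkThread` (coefficient field = ground field); here the coefficient field of the anchor at the `k`-th thread
point is ANY perfect field `L_k` of characteristic `p` embedded in a fixed algebraically closed `Ω`, and the model state is `f ⊗ Ω`.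

* the per-point facts for an anchor over `L` are res-L1-s46-pv-6 (gen 8)'s `…WWalkNRPoint.residual_facts` / `bdiv_lt_of_wAnchor`
  (landed in parallel with this seat's identical draft `residual_facts_L` / `bdiv_lt_of_wAnchor_L`, HOME `L/res-L1-s46-pv-5/wwalk7/NRThread.lean` —
  imported, not forked);
* `wAnchor_succ_nr` — ONE STEP: if the thread point is blown up, the child carries a `w`-anchor over `L_{k+1} = L_k(λ)` whose model, read in
  `Ω`, is `stepT p l γ F` (`T`-step) or `stepT p 0 γ (swapTY F)` (sharp-vertical step) with the boundary bookkeeping of `…WWalkModel.bdiv_stepT`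
  and `ord ≥ p + 1` after cleaning (`…WWalkNRStep.exists_wAnchor_step_nr`, `…WWalkPoint.cleaningData_of_wAnchor` over `L_{k+1}`,
  `…WWalkStepForms.exists_ringEquiv_clean`, `…WWalkMapModel`); off the centre the anchor is carried verbatim
  (res-L1-s46-pv-6 `exists_formalNRAnchor_offCentre`). The scheme-level step is `…WWalkPortableStep.exists_wAnchor_step_nr`.

HONEST FRAMING. OURS; nothing here is a statement of H. Hironaka's manuscript [Hironaka2017] and nothing of it is used. AI-written; AI review
is weaker than expert review. No `sorry`; axioms standard. References: Stacks Project Tag 0804 [StacksProject]; H. Matsumura (1986) Thm. 8.11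
[Matsumura1987]; H. Hauser, Bull. AMS 47 (2010) §§F–G [Hauser2010]. [folklore]
-/

noncomputable section

set_option linter.dupNamespace false -- mandated namespace of this single-conjunct summit

open MvPowerSeries IsLocalRing Finset
open Literature.AlgebraicGeometry.Resolution
open Literature.RingTheory.MvPowerSeries.Jets (mem_maximalIdeal_iff_constantCoeff_eq_zero mem_maximalIdeal_pow_iff)

namespace Summit.ResolutionOfSingularities.ResolutionOfSingularities.Theorems

namespace CampaignW46

namespace WWalk

open CategoryTheory AlgebraicGeometry TopologicalSpace
open Literature.AlgebraicGeometry.Hironaka2017.S02Preliminaries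
open Literature.AlgebraicGeometry.Hironaka2017.Datum
open Scheme.IdealSheafData
open CampaignW46.FormalChart (ringEquiv_mem_maximalIdeal ringEquiv_mem_maximalIdeal_pow)
open CampaignW46.AtomGerm (mem_maximalIdeal_pow_iff_algebraMap)
open CampaignW46.MohWindowShadeFormalNR (exists_formalNRAnchor_offCentre order_map_of_injective)

variable {p : ℕ} [hp : Fact p.Prime] {K : Type} [Field K] [CharP K p]

/-! ## §2 One step along a hit thread, model states in `Ω⟦t, y, z⟧` -/

variable {Ω : Type} [Field Ω] [IsAlgClosed Ω]

/-- **ONE STEP ALONG A HIT THREAD, `w`-anchors over the residue fields, model read in `Ω`.** See the module docstring.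
[cite: StacksProject, Tag 0804] [cite: Matsumura1987, Thm. 8.11] -/
theorem wAnchor_succ_nr [DecidableEq Ω] (r : PermissibleRun p K) (hr : ∀ k, regimeMohWindowSurfaceInsep (p := p) (K := K) (r.A k) (r.E k))
    (t : r.HitThread) (k : ℕ) (F : MvPowerSeries (Option (Fin 2)) Ω) (rt ry : ℕ)
    (hA : ∃ (L : Type) (_ : Field L) (_ : CharP L p) (_ : PerfectField L) (ι : L →+* Ω)
      (e : AdicCompletion (maximalIdeal ((r.A k).Z.presheaf.stalk (t.y k))) ((r.A k).Z.presheaf.stalk (t.y k)) ≃+* MvPowerSeries (Option (Fin 2)) L)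
      (f₀ : (r.A k).Z.presheaf.stalk (t.y k)) (w f : MvPowerSeries (Option (Fin 2)) L),
      stalkIdeal (r.E k).J (t.y k) = Ideal.span {f₀} ∧ IsUnit w ∧ e (algebraMap _ _ f₀) = w * (X none ^ p + f) ∧ MvPowerSeries.map ι f = F)
    (hP2 : LowVanish (p + 1) F) (hB : BDiv rt ry F) :
    ∃ (F' : MvPowerSeries (Option (Fin 2)) Ω) (rt' ry' : ℕ) (v : Bool) (l γ : Ω),
      ((r.D k : Set (r.A k).Z) = {t.y k} →
        (v = false → F' = stepT p l γ F ∧ rt' = F.order.toNat - p ∧ ry' = (if l = 0 then ry else 0) ∧ (l = 0 → 0 < ry → γ = 0)) ∧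
        (v = true → F' = stepT p 0 γ (swapTY F) ∧ rt' = F.order.toNat - p ∧ ry' = rt ∧ (0 < rt → γ = 0))) ∧
      ((r.D k : Set (r.A k).Z) ≠ {t.y k} → F' = F ∧ rt' = rt ∧ ry' = ry) ∧
      (∃ (L : Type) (_ : Field L) (_ : CharP L p) (_ : PerfectField L) (ι : L →+* Ω)
        (e : AdicCompletion (maximalIdeal ((r.A (k + 1)).Z.presheaf.stalk (t.y (k + 1)))) ((r.A (k + 1)).Z.presheaf.stalk (t.y (k + 1))) ≃+*
          MvPowerSeries (Option (Fin 2)) L) (f₀ : (r.A (k + 1)).Z.presheaf.stalk (t.y (k + 1))) (w f : MvPowerSeries (Option (Fin 2)) L),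
        stalkIdeal (r.E (k + 1)).J (t.y (k + 1)) = Ideal.span {f₀} ∧ IsUnit w ∧ e (algebraMap _ _ f₀) = w * (X none ^ p + f) ∧
          MvPowerSeries.map ι f = F') ∧
      LowVanish (p + 1) F' ∧ BDiv rt' ry' F' := by
  classical
  obtain ⟨L, _, _, _, ι, eA, f₀A, wA, fA, hJA, hwA, hEA, hFA⟩ := hA
  haveI : PerfectRing L p := PerfectField.toPerfectRing p
  have hc := t.compat k
  have hmem : (r.π k).base (t.y (k + 1)) ∈ (r.E k).sing := by rw [hc]; exact t.mem k
  obtain ⟨hR, h3, hcl, -, hb⟩ := MohWindowShadeAnchorWalk.regime_point (hr k) hmem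
  haveI := hR
  -- invariants of the `L`-model
  have hP2L : LowVanish (p + 1) fA := by rw [← lowVanish_map_iff ι.injective, hFA]; exact hP2
  have hBL : BDiv rt ry fA := by rw [← bdiv_map_iff ι.injective, hFA]; exact hB
  -- move the anchor to the point `(r.π k) (t.y (k+1)) = t.y k`
  have hA' : ∃ (e : AdicCompletion (maximalIdeal ((r.A k).Z.presheaf.stalk ((r.π k).base (t.y (k + 1)))))
        ((r.A k).Z.presheaf.stalk ((r.π k).base (t.y (k + 1)))) ≃+* MvPowerSeries (Option (Fin 2)) L)
      (f₀ : (r.A k).Z.presheaf.stalk ((r.π k).base (t.y (k + 1)))),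
      stalkIdeal (r.E k).J ((r.π k).base (t.y (k + 1))) = Ideal.span {f₀} ∧ e (algebraMap _ _ f₀) = wA * (X none ^ p + fA) := by
    rw [hc]; exact ⟨eA, f₀A, hJA, hEA⟩
  obtain ⟨e, f₀, hJ, hE⟩ := hA'
  -- the parent's window: `d = ord f ∈ [p+1, 2p−1]`
  obtain ⟨d, hd, hpd, hd2, hlowd, -, -⟩ := WWalkNR.residual_facts (hr k) hmem e hJ hwA hE hP2L hBL
  have hdto : F.order.toNat = d := by rw [← hFA, order_map_of_injective ι ι.injective, hd]; rfl
  have hsing' : t.y (k + 1) ∈ ((r.E k).transform (r.π k) (r.D k)).sing := by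
    have := t.mem (k + 1); rwa [r.E_succ k] at this
  -- the child's regime data
  obtain ⟨hR', h3', -, -, hb'⟩ := MohWindowShadeAnchorWalk.regime_point (hr (k + 1)) (t.mem (k + 1))
  haveI := hR'
  haveI : IsDomain ((r.A (k + 1)).Z.presheaf.stalk (t.y (k + 1))) := isDomain_of_isRegularLocalRing _
  have hcoeff' : MohWindowSurfaceCoeffAt p ((r.A (k + 1)).Z.presheaf.stalk (t.y (k + 1))) (stalkIdeal (r.E (k + 1)).J (t.y (k + 1))) :=
    coeffAt_of_regime (hr (k + 1)) (t.mem (k + 1))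
  by_cases hhit : (r.D k : Set (r.A k).Z) = {t.y k}
  · -- the thread point is blown up: a model step at an ARBITRARY closed singular child
    have hD : (r.D k : Set (r.A k).Z) = {(r.π k).base (t.y (k + 1))} := by rw [hc]; exact hhit
    obtain ⟨K₁, _, _, _, φ, ι₁, E', f', w', hι₁, hJ', hw', hcase⟩ :=
      exists_wAnchor_step_nr ι (r.π k) (r.D k) (r.blowup k) hb hD hmem hsing' h3 hR' h3' e hJ hwA fA hP2L hE
    have hJ'' : stalkIdeal (r.E (k + 1)).J (t.y (k + 1)) = Ideal.span {f'} := by rw [r.E_succ k]; exact hJ'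
    have hιφ : ι₁.comp φ = ι := RingHom.ext hι₁
    have hmapφ : MvPowerSeries.map ι₁ (MvPowerSeries.map φ fA) = F := by
      rw [← hFA, ← hιφ]; ext e'; simp only [coeff_map, RingHom.comp_apply]
    -- `f' ∈ 𝔪^p`, so the uncleaned residual has order `≥ p`
    have hf'𝔪 : f' ∈ maximalIdeal ((r.A (k + 1)).Z.presheaf.stalk (t.y (k + 1))) ^ p := by
      have h := (le_idealOrder_iff (r.E (k + 1)).J (t.y (k + 1)) (r.E (k + 1)).b).mp (t.mem (k + 1))
      rw [hJ'', Ideal.span_singleton_le_iff_mem, hb'] at h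
      exact h
    have lowp : ∀ {f₁ w₁ : MvPowerSeries (Option (Fin 2)) K₁}, IsUnit w₁ →
        E' (algebraMap _ _ f') = w₁ * (X none ^ p + f₁) → LowVanish p f₁ := by
      intro f₁ w₁ hw₁ hE₁
      have h1 : w₁ * (X none ^ p + f₁) ∈ maximalIdeal (MvPowerSeries (Option (Fin 2)) K₁) ^ p := by
        rw [← hE₁]; exact ringEquiv_mem_maximalIdeal_pow E' ((mem_maximalIdeal_pow_iff_algebraMap p f').mp hf'𝔪)
      have h2 : X none ^ p + f₁ ∈ maximalIdeal (MvPowerSeries (Option (Fin 2)) K₁) ^ p := (Ideal.unit_mul_mem_iff_mem _ hw₁).mp h1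
      have h3 : f₁ ∈ maximalIdeal (MvPowerSeries (Option (Fin 2)) K₁) ^ p := by
        have : f₁ = (X none ^ p + f₁) - X none ^ p := by ring
        rw [this]
        exact Ideal.sub_mem _ h2 (Ideal.pow_mem_pow (mem_maximalIdeal_iff_constantCoeff_eq_zero.mpr (constantCoeff_X _)) p)
      exact mem_maximalIdeal_pow_iff.mp h3
    have hP2φ : LowVanish (p + 1) (MvPowerSeries.map φ fA) := (lowVanish_map_iff φ.injective).mpr hP2L
    have hBφ : BDiv rt ry (MvPowerSeries.map φ fA) := (bdiv_map_iff φ.injective).mpr hBL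
    have hlowdΩ : LowVanish d F := by rw [← hFA, lowVanish_map_iff ι.injective]; exact hlowd
    rcases hcase with ⟨l₁, hE'⟩ | hE'
    · -- `T`-step at `(1 : λ : 0)`
      have hlow₁ := lowp hw' hE'
      obtain ⟨hdeg, β', hβ'⟩ := cleaningData_of_wAnchor hcoeff' E' hJ'' hw' hE' (coeff_chartT_texp_zero hP2φ 0 p) (coeff_chartT_texp_zero hP2φ p 0)
      obtain ⟨E'', w'', hw'', hE''⟩ := exists_ringEquiv_clean E' (algebraMap _ _ f') w' hw' l₁ β' (MvPowerSeries.map φ fA) hE'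
      have hγ0₁ : l₁ = 0 → 0 < ry → β' = 0 := by
        intro hl hry
        have h0 : coeff (mk3 p 0 0) (chartT p l₁ (MvPowerSeries.map φ fA)) = 0 := by rw [hl]; exact coeff_chartT_eq_zero_of_lt_ry hBφ hry
        rw [h0] at hβ'
        exact (pow_eq_zero_iff hp.out.ne_zero).mp hβ'.symm
      have hγ0 : ι₁ l₁ = 0 → 0 < ry → ι₁ β' = 0 := by
        intro hl hry
        rw [map_eq_zero_iff ι₁ ι₁.injective] at hl
        rw [hγ0₁ hl hry, map_zero]
      have hstep : MvPowerSeries.map ι₁ (stepT p l₁ β' (MvPowerSeries.map φ fA)) = stepT p (ι₁ l₁) (ι₁ β') F := by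
        rw [map_stepT, hmapφ]
      refine ⟨stepT p (ι₁ l₁) (ι₁ β') F, d - p, if ι₁ l₁ = 0 then ry else 0, false, ι₁ l₁, ι₁ β', fun _ => ⟨fun _ => ⟨rfl, by rw [hdto], rfl, hγ0⟩,
        fun h => absurd h (by decide)⟩, fun h => absurd hhit h,
        ⟨K₁, inferInstance, inferInstance, inferInstance, ι₁, E'', f', w'', _, hJ'', hw'', hE'', hstep⟩, ?_, ?_⟩
      · rw [← hstep, lowVanish_map_iff ι₁.injective]; exact lowVanish_succ_stepT hlow₁ hdeg hβ'
      · exact bdiv_stepT hlowdΩ hB hpd (by omega) hγ0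
    · -- sharp-vertical step at `(0 : 1 : 0)`
      have hlow₁ := lowp hw' hE'
      have hP2s : LowVanish (p + 1) (swapTY (MvPowerSeries.map φ fA)) := lowVanish_swapTY hP2φ
      have hBs : BDiv ry rt (swapTY (MvPowerSeries.map φ fA)) := bdiv_swapTY hBφ
      obtain ⟨hdeg, β', hβ'⟩ := cleaningData_of_wAnchor hcoeff' E' hJ'' hw' hE' (coeff_chartT_texp_zero hP2s 0 p) (coeff_chartT_texp_zero hP2s p 0)
      obtain ⟨E'', w'', hw'', hE''⟩ := exists_ringEquiv_clean E' (algebraMap _ _ f') w' hw' 0 β' (swapTY (MvPowerSeries.map φ fA)) hE'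
      have hγ0₁ : 0 < rt → β' = 0 := by
        intro hrt
        have h0 : coeff (mk3 p 0 0) (chartT p (0 : K₁) (swapTY (MvPowerSeries.map φ fA))) = 0 := coeff_chartT_eq_zero_of_lt_ry hBs hrt
        rw [h0] at hβ'
        exact (pow_eq_zero_iff hp.out.ne_zero).mp hβ'.symm
      have hγ0 : (0 : Ω) = 0 → 0 < rt → ι₁ β' = 0 := fun _ hrt => by rw [hγ0₁ hrt, map_zero]
      have hstep : MvPowerSeries.map ι₁ (stepT p 0 β' (swapTY (MvPowerSeries.map φ fA))) = stepT p 0 (ι₁ β') (swapTY F) := by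
        rw [map_stepT, map_swapTY, hmapφ, map_zero]
      refine ⟨stepT p 0 (ι₁ β') (swapTY F), d - p, rt, true, 0, ι₁ β', fun _ => ⟨fun h => absurd h (by decide),
        fun _ => ⟨rfl, by rw [hdto], rfl, hγ0 rfl⟩⟩, fun h => absurd hhit h,
        ⟨K₁, inferInstance, inferInstance, inferInstance, ι₁, E'', f', w'', _, hJ'', hw'', hE'', hstep⟩, ?_, ?_⟩
      · rw [← hstep, lowVanish_map_iff ι₁.injective]; exact lowVanish_succ_stepT hlow₁ hdeg hβ'
      · have h := bdiv_stepT (l := (0 : Ω)) (γ := ι₁ β') (lowVanish_swapTY hlowdΩ) (bdiv_swapTY hB) hpd (by omega) hγ0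
        rw [if_pos rfl] at h
        exact h
  · -- the thread point is not blown up: transport
    obtain ⟨ξ₀, -, -, hDξ₀⟩ := IsPermissibleCentre.exists_eq_singleton_of_isolatedSing (r.permissible k)
      ((regimeMohWindowSurfaceInsep_iff _ _).mp (hr k)).1.1
    have hoff : (r.π k).base (t.y (k + 1)) ∉ (r.D k : Set (r.A k).Z) := by
      rw [hc, hDξ₀, Set.mem_singleton_iff]
      rintro rfl
      exact hhit hDξ₀
    obtain ⟨e', f', hJ', hE'⟩ := exists_formalNRAnchor_offCentre (E := r.E k) (r.π k) (r.blowup k) hoff e hJ _ hE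
    refine ⟨F, rt, ry, false, 0, 0, fun h => absurd h hhit, fun _ => ⟨rfl, rfl, rfl⟩,
      ⟨L, inferInstance, inferInstance, inferInstance, ι, e', f', wA, fA, ?_, hwA, hE', hFA⟩, hP2, hB⟩
    rw [r.E_succ k]; exact hJ'

end WWalk

end CampaignW46

end Summit.ResolutionOfSingularities.ResolutionOfSingularities.Theorems

end
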